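import Summits.Ventures.PercRepro.RankLevelSetHallRuleLUniformTools

/-!
# PercRepro — RULE L PAYS EVERY MEMBER WHOSE CLOSURE IS A UNIFORM FLAT (p4, gen 30; C-044, UP form at the tight
layer; paper proofs/P4-CELL-THREE.md §14.12)

At the tight layer `#E = p + q` let `Z` be a member of the cell `(p, q)` with closure `F = cl Z`, flat part `P = F ∖ Z`
(`m = #P`) and free part `D = E ∖ F`.  ASSUME (U): every subset of `F` with at most `q` elements is independent (`M|F` is
the uniform matroid `U_{q,#F}`).  THEN Rule L pays `Z`: `Φ(p,q) ≤ ruleLRecv Z`.  By `ruleLRecv_eq` (RankLevelSetHallRuleLExact)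
it suffices that the big-set receipt covers the LYM defect, `δ(Z) ≤ ruleLBig Z`, and ONE family of big sets does it:
fix `X_D ⊆ D` with `#X_D = p − q − 1` and `Z ∪ X_D` independent (a basis of `Z ∪ D` through `Z` has `≥ p` elements, since
`r(Z ∪ D) ≥ r(E ∖ Z) = p`); for every nonempty `X_P ⊆ P` the set `S = Z ∪ X_P ∪ X_D` is a big `Y`-set through `Z`
(`#S = p − 1 + #X_P ≥ p`, `r(S) = p − 1`) in which `Z` is eligible, and **its eligible members are `q`-subsets of `Z ∪ X_P`**:
a member `Z′ ⊆ S` using `t ≥ 1` points of `X_D` has `A = Z′ ∖ X_D ⊆ F` of size `q − t`, and for every `e ∈ S ∖ Z′` the set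
`insert e Z′` is independent — `A ∪ {e} ⊆ F` has `≤ q` elements (independent by (U)) when `e ∈ F`, and a subset of `F` that
is independent stays independent after adjoining any part of `X_D` (`indep_union_of_subset_closure`: submodularity against
`F`, with `r(F ∪ T) = r(Z ∪ T) = q + #T`) — so `e ∉ cl Z′` and `Z′` is not eligible.  Hence `eligCount S ≤ C(q + #X_P, q)`
(`ncard_members_subset_le_choose`), the family injects into the big eligible `Y`-sets, and
`ruleLBig Z ≥ Σ_{∅ ≠ X_P ⊆ P} 1/C(q + #X_P, q) = Σ_{i<m} C(m, i+1)/C(q+i+1, q) ≥ δ(Z)`.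
* the tools (`indep_union_of_subset_closure`, `not_eligible_of_inter_free`, `eligCount_le_choose_of_uniform`,
  `exists_free_indep`) are in RankLevelSetHallRuleLUniformTools;
* **`lymDefect_le_ruleLBig_of_uniform`**, **`ruleL_pays_of_uniform_flat`** — `δ(Z) ≤ ruleLBig Z` and `Φ(p,q) ≤ ruleLRecv Z`
  under (U).
On the model family `T_p(U_{q,q+m} ⊕ free)` every member satisfies (U) or has an empty flat part, so Rule L pays every
member of the model family (night-1's «Rule L is exact on the model», now from (U) alone).  Axioms standard.
-/

namespace PercRepro

open Set Matroid Finset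

variable {α : Type} (M : Matroid α) [M.Finite]

/-- **The big-set receipt covers the LYM defect under (U)**: `δ(Z) ≤ ruleLBig Z`. -/
theorem lymDefect_le_ruleLBig_of_uniform (p q : ℕ) (hE : M.E.ncard = p + q) (hpq : q + 2 ≤ p) {Z : Set α}
    (hZ : Z ∈ cellMembers M p q) (hU : ∀ A ⊆ M.closure Z, A.ncard ≤ q → M.Indep A) :
    lymDefect M p q Z ≤ ruleLBig M p q Z := by
  classical
  -- the data
  have hZE : Z ⊆ M.E := hZ.1
  have hEfin : M.E.Finite := M.ground_finite
  have hZfin : Z.Finite := hEfin.subset hZE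
  have hZcard : Z.ncard = q := ncard_eq_q_of_mem_cellMembers_tight M hE hZ
  have hqZ : M.eRk Z = (q : ℕ∞) := hZ.2.1
  have hPsub : flatPart M Z ⊆ M.E \ Z := fun x hx => hx.1
  have hPfin : (flatPart M Z).Finite := (hEfin.subset Set.sdiff_subset).subset hPsub
  set m := (flatPart M Z).ncard with hm
  obtain ⟨X_D, hXD, hXDcard, hZXD⟩ := exists_free_indep M hE hZ (p - q - 1) (by omega)
  have hXDE : X_D ⊆ M.E := fun x hx => (hXD hx).1
  have hXDfin : X_D.Finite := hEfin.subset hXDE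
  have hXDcl : Disjoint X_D (M.closure Z) := Set.disjoint_left.2 (fun x hx => (hXD hx).2)
  set Pf : Finset α := hPfin.toFinset with hPf
  have hPfcard : Pf.card = m := by rw [hPf, ← ncard_eq_toFinset_card _ hPfin]
  -- the big sets S(X_P) = Z ∪ X_P ∪ X_D for nonempty X_P ⊆ P
  let S : Finset α → Set α := fun X => Z ∪ (X : Set α) ∪ X_D
  have hXPsub : ∀ X ∈ Pf.powerset, (X : Set α) ⊆ flatPart M Z := by
    intro X hX x hx
    rw [Finset.mem_powerset] at hX
    have := hX hx
    rwa [hPf, hPfin.mem_toFinset] at this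
  have hScard : ∀ X ∈ Pf.powerset, (S X).ncard = q + X.card + (p - q - 1) := by
    intro X hX
    have hXsub := hXPsub X hX
    have hdisj1 : Disjoint Z (X : Set α) := Set.disjoint_left.2 (fun x hxZ hxX => (hXsub hxX).1.2 hxZ)
    have hdisj2 : Disjoint (Z ∪ (X : Set α)) X_D := by
      rw [Set.disjoint_left]
      rintro x (hxZ | hxX) hxD
      · exact (hXD hxD).2 (M.subset_closure Z hZE hxZ)
      · exact (hXD hxD).2 (hXsub hxX).2
    show (Z ∪ (X : Set α) ∪ X_D).ncard = q + X.card + (p - q - 1)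
    rw [Set.ncard_union_eq hdisj2 (hZfin.union X.finite_toSet) hXDfin, Set.ncard_union_eq hdisj1 hZfin X.finite_toSet,
      hZcard, Set.ncard_coe_finset, hXDcard]
  have hSrk : ∀ X ∈ Pf.powerset, M.eRk (S X) = ((q + (p - q - 1) : ℕ) : ℕ∞) := by
    intro X hX
    have hXsub := hXPsub X hX
    have hXcl : (X : Set α) ⊆ M.closure Z := fun x hx => (hXsub hx).2
    apply le_antisymm
    · calc M.eRk (S X) ≤ M.eRk (M.closure Z ∪ X_D) := M.eRk_mono (by
            intro x hx
            rcases hx with (hxZ | hxX) | hxD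
            · exact Or.inl (M.subset_closure Z hZE hxZ)
            · exact Or.inl (hXcl hxX)
            · exact Or.inr hxD)
        _ = M.eRk (Z ∪ X_D) := M.eRk_union_closure_left_eq Z X_D
        _ = ((q + (p - q - 1) : ℕ) : ℕ∞) := by
            rw [hZXD.eRk_eq_encard, Set.encard_union_eq (Set.disjoint_left.2
              (fun x hxZ hxD => (hXD hxD).2 (M.subset_closure Z hZE hxZ))), ← hZfin.cast_ncard_eq,
              ← hXDfin.cast_ncard_eq, hZcard, hXDcard]
            norm_cast
    · calc ((q + (p - q - 1) : ℕ) : ℕ∞) = M.eRk (Z ∪ X_D) := by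
            rw [hZXD.eRk_eq_encard, Set.encard_union_eq (Set.disjoint_left.2
              (fun x hxZ hxD => (hXD hxD).2 (M.subset_closure Z hZE hxZ))), ← hZfin.cast_ncard_eq,
              ← hXDfin.cast_ncard_eq, hZcard, hXDcard]
            norm_cast
        _ ≤ M.eRk (S X) := M.eRk_mono (by
            intro x hx
            rcases hx with hxZ | hxD
            · exact Or.inl (Or.inl hxZ)
            · exact Or.inr hxD)
  have hSY : ∀ X ∈ Pf.powerset, S X ∈ cellY M p q := by
    intro X hX
    refine ⟨?_, ?_, ?_⟩
    · intro x hx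
      rcases hx with (hxZ | hxX) | hxD
      · exact hZE hxZ
      · exact (hXPsub X hX hxX).1.1
      · exact hXDE hxD
    · rw [hSrk X hX]; exact_mod_cast (show q < q + (p - q - 1) by omega)
    · rw [hSrk X hX]; exact_mod_cast (show q + (p - q - 1) < p by omega)
  -- the injection into the Y-Finset
  have hinj : Set.InjOn S (Pf.powerset.filter (fun X => X.Nonempty) : Set (Finset α)) := by
    intro X₁ hX₁ X₂ hX₂ heq
    simp only [Finset.coe_filter, Finset.mem_powerset, Set.mem_setOf_eq] at hX₁ hX₂
    have key : ∀ X : Finset α, X ⊆ Pf → ((S X) ∩ flatPart M Z : Set α) = (X : Set α) := by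
      intro X hXP'
      ext x
      constructor
      · rintro ⟨(hxZ | hxX) | hxD, hxP⟩
        · exact absurd hxZ hxP.1.2
        · exact hxX
        · exact absurd hxP.2 (hXD hxD).2
      · intro hx
        have hxP : x ∈ flatPart M Z := by
          have := hXP' hx
          rwa [hPf, hPfin.mem_toFinset] at this
        exact ⟨Or.inl (Or.inr hx), hxP⟩
    have h : (S X₁) ∩ flatPart M Z = (S X₂) ∩ flatPart M Z := by rw [heq]
    rw [key X₁ hX₁.1, key X₂ hX₂.1] at h
    exact Finset.coe_inj.1 h
  -- ruleLBig ≥ the sum over the family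
  have hbig : ∑ X ∈ Pf.powerset.filter (fun X => X.Nonempty), 1 / ((eligCount M p q (S X) : ℕ) : ℚ)
      ≤ ruleLBig M p q Z := by
    unfold ruleLBig
    have himg : (Pf.powerset.filter (fun X => X.Nonempty)).image S ⊆ (cellY_finite M p q).toFinset := by
      intro T hT
      rw [Finset.mem_image] at hT
      obtain ⟨X, hX, rfl⟩ := hT
      rw [(cellY_finite M p q).mem_toFinset]
      exact hSY X (Finset.mem_filter.1 hX).1
    calc ∑ X ∈ Pf.powerset.filter (fun X => X.Nonempty), 1 / ((eligCount M p q (S X) : ℕ) : ℚ)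
        = ∑ T ∈ (Pf.powerset.filter (fun X => X.Nonempty)).image S,
            (if Z ⊆ T ∧ ¬ T.ncard < p ∧ (∃ e ∈ T, e ∉ Z ∧ M.eRk (insert e Z) = (q : ℕ∞)) then
              1 / ((eligCount M p q T : ℕ) : ℚ) else 0) := by
          rw [Finset.sum_image hinj]
          refine Finset.sum_congr rfl (fun X hX => ?_)
          rw [Finset.mem_filter] at hX
          obtain ⟨x, hx⟩ := hX.2
          have hXsub := hXPsub X hX.1
          have hxP : x ∈ flatPart M Z := hXsub hx
          have hbigS : ¬ (S X).ncard < p := by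
            rw [hScard X hX.1]
            have : 1 ≤ X.card := Finset.card_pos.2 ⟨x, hx⟩
            omega
          have hxrk : M.eRk (insert x Z) = (q : ℕ∞) := by
            rw [← M.eRk_insert_closure_eq, Set.insert_eq_of_mem hxP.2, M.eRk_closure_eq, hqZ]
          have hcond : Z ⊆ S X ∧ ¬ (S X).ncard < p ∧ (∃ e ∈ S X, e ∉ Z ∧ M.eRk (insert e Z) = (q : ℕ∞)) :=
            ⟨fun y hy => Or.inl (Or.inl hy), hbigS, ⟨x, Or.inl (Or.inr hx), hxP.1.2, hxrk⟩⟩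
          rw [if_pos hcond]
      _ ≤ _ := Finset.sum_le_sum_of_subset_of_nonneg himg (fun T _ _ => by split_ifs <;> positivity)
  -- termwise: 1/eligCount ≥ 1/C(q + #X, q)
  have hterm : ∀ X ∈ Pf.powerset.filter (fun X => X.Nonempty),
      1 / (((q + X.card).choose q : ℕ) : ℚ) ≤ 1 / ((eligCount M p q (S X) : ℕ) : ℚ) := by
    intro X hX
    rw [Finset.mem_filter] at hX
    obtain ⟨x, hx⟩ := hX.2
    have hXsub := hXPsub X hX.1
    have hle : eligCount M p q (S X) ≤ (q + X.card).choose q := by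
      have := eligCount_le_choose_of_uniform M hE hZ hU hXsub hXD hZXD
      have hcard : (Z ∪ (X : Set α)).ncard = q + X.card := by
        rw [Set.ncard_union_eq (Set.disjoint_left.2 (fun y hyZ hyX => (hXsub hyX).1.2 hyZ)) hZfin X.finite_toSet,
          hZcard, Set.ncard_coe_finset]
      rwa [hcard] at this
    have hpos : 0 < eligCount M p q (S X) := by
      unfold eligCount
      rw [Set.ncard_pos ((cellMembers_finite M p q).subset (fun _ h => h.1))]
      refine ⟨Z, hZ, fun y hy => Or.inl (Or.inl hy), x, Or.inl (Or.inr hx), (hXsub hx).1.2, ?_⟩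
      rw [← M.eRk_insert_closure_eq, Set.insert_eq_of_mem (hXsub hx).2, M.eRk_closure_eq, hqZ]
    have hposq : (0 : ℚ) < ((eligCount M p q (S X) : ℕ) : ℚ) := by exact_mod_cast hpos
    exact one_div_le_one_div_of_le hposq (by exact_mod_cast hle)
  -- the family's sum in closed form
  have hsum : ∑ X ∈ Pf.powerset.filter (fun X => X.Nonempty), 1 / (((q + X.card).choose q : ℕ) : ℚ)
      = ∑ i ∈ range m, (m.choose (i + 1) : ℚ) * (1 / (((q + (i + 1)).choose q : ℕ) : ℚ)) := by
    have h := sum_powerset_supported Pf (m + 1) (fun j => 1 / (((q + j).choose q : ℕ) : ℚ))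
    rw [hPfcard, show m + 1 - 1 = m by omega] at h
    rw [← h, Finset.sum_filter]
    refine Finset.sum_congr rfl (fun X hX => ?_)
    rw [Finset.mem_powerset] at hX
    have hXle : X.card ≤ m := by rw [← hPfcard]; exact Finset.card_le_card hX
    by_cases hne : X.Nonempty
    · rw [if_pos hne, if_pos ⟨Finset.card_pos.2 hne, by omega⟩]
    · rw [if_neg hne, if_neg (fun h => hne (Finset.card_pos.1 h.1))]
  -- δ(Z) ≤ the closed form
  have hdelta : lymDefect M p q Z ≤ ∑ i ∈ range m, (m.choose (i + 1) : ℚ) * (1 / (((q + (i + 1)).choose q : ℕ) : ℚ)) := by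
    unfold lymDefect
    rw [← hm]
    have hL : ∑ i ∈ range (p - q - 1), (m.choose (i + 1) : ℚ) / ((q + i + 1).choose q : ℚ)
        ≤ ∑ i ∈ range (p - q - 1 + m), (m.choose (i + 1) : ℚ) / ((q + i + 1).choose q : ℚ) := by
      refine Finset.sum_le_sum_of_subset_of_nonneg (by
        intro x hx
        rw [Finset.mem_range] at hx ⊢
        omega) (fun i _ _ => by positivity)
    have h1 : ∀ i : ℕ, (m.choose (i + 1) : ℚ) * (1 / (((q + (i + 1)).choose q : ℕ) : ℚ))
        = (m.choose (i + 1) : ℚ) / ((q + i + 1).choose q : ℚ) := by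
      intro i
      rw [show q + (i + 1) = q + i + 1 by ring, mul_one_div]
    have hR : ∑ i ∈ range m, (m.choose (i + 1) : ℚ) * (1 / (((q + (i + 1)).choose q : ℕ) : ℚ))
        = ∑ i ∈ range (p - q - 1 + m), (m.choose (i + 1) : ℚ) / ((q + i + 1).choose q : ℚ) := by
      simp only [h1]
      refine Finset.sum_subset (by
        intro x hx
        rw [Finset.mem_range] at hx ⊢
        omega) (fun i hi hi' => ?_)
      rw [Finset.mem_range] at hi hi'
      rw [Nat.choose_eq_zero_of_lt (by omega)]
      simp
    rw [hR]
    exact hL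
  calc lymDefect M p q Z ≤ _ := hdelta
    _ = ∑ X ∈ Pf.powerset.filter (fun X => X.Nonempty), 1 / (((q + X.card).choose q : ℕ) : ℚ) := hsum.symm
    _ ≤ ∑ X ∈ Pf.powerset.filter (fun X => X.Nonempty), 1 / ((eligCount M p q (S X) : ℕ) : ℚ) :=
        Finset.sum_le_sum hterm
    _ ≤ ruleLBig M p q Z := hbig

/-- **Rule L pays every member whose closure is a uniform flat** (at the tight layer, `p ≥ q + 2`). -/
theorem ruleL_pays_of_uniform_flat (p q : ℕ) (hE : M.E.ncard = p + q) (hpq : q + 2 ≤ p) {Z : Set α}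
    (hZ : Z ∈ cellMembers M p q) (hU : ∀ A ⊆ M.closure Z, A.ncard ≤ q → M.Indep A) :
    phiK p q ≤ ruleLRecv M p q Z := by
  rw [ruleLRecv_eq M p q hE (by omega) hZ]
  have := lymDefect_le_ruleLBig_of_uniform M p q hE hpq hZ hU
  linarith

end PercRepro
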